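import Mathlib.MeasureTheory.Integral.IntervalIntegral.FundThmCalculus
import Literature.Analysis.FunctionSpaces.TorusSpaceTime
import Summits.AtomisticToContinuum.HydrodynamicLimit.Theorems.CollisionIsometryCLTMacroClosureDefs

/-!
# Stub `stub_balance_B1` of the line `IdeatorTwoGen1Sketch` (crux `MacroClosure`, stmt-14870):
# the pathwise position functional along good hard-sphere trajectories

Conjunct (B1) of `BalanceIdentity`: on a GOOD trajectory `s ↦ Φ_s z` of a hard-sphere flow and for a
jointly smooth space–time test function `lam0` on `[0, t] × T³`, the empirical position functional
`F(τ) = ⟨emp(Φ_τ z), lam0(τ, ·)⟩ = (N+1)⁻¹ Σᵢ lam0(τ, xᵢ(τ))` satisfies, for every `τ ∈ [0, t]`,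
`F(τ) - F(0) = ∫₀^τ ⟨emp(Φ_s z), ∂ₛlam0(s, ·) + v · ∇lam0(s, ·)⟩ ds`.

Proof (particle by particle, then the finite average `integral_empiricalMeasure`): by the trajectory
axioms (`IsHardSphereTrajectory`: continuous positions, locally finitely many collision times, free
flight `x ↦ x + proj (r • v)` on every collision-free `(s, s']`, right-continuity at collisions) the
map `s ↦ lam0 (s, xᵢ(s))` is continuous on `[0, t]` and has the RIGHT derivative
`∂ₛlam0(s, xᵢ(s)) + Σⱼ vᵢ(s)ⱼ ∂ⱼlam0(s, xᵢ(s))` at every `s ∈ (0, t)` (chain rule through the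
space–time lift `Torus.stLift lam0`, which is `C^∞` on `[0,t] × ℝ³`); the right derivative is
interval integrable (it is continuous on every collision-free open interval, the velocity being
constant there, and the collision times in `[0, t]` are finite — induction on that finite set); the
fundamental theorem of calculus for right derivatives
(`intervalIntegral.integral_eq_sub_of_hasDeriv_right_of_le`) concludes.
-/

noncomputable section

open MeasureTheory Filter Set Topology InformationTheory
open scoped ENNReal ContDiff

namespace Summit.AtomisticToContinuum.HydrodynamicLimit.Theorems.MacroClosureLine

open Literature.MathematicalPhysics.KineticTheory Literature.Analysis.FluidPDE
open Literature.Analysis.FunctionSpaces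

namespace Barycentric

/-! ## Space–time calculus on `[0, t] × T³` -/

section SpaceTime

/-- Descent of joint continuity through the open quotient map `id × proj : ℝ × ℝ³ → ℝ × T³`:
if the space–time lift `(s, y) ↦ u s (proj y)` is continuous on `S × ℝ³`, then `(s, x) ↦ u s x` is
continuous on `S × T³` (adapted from `continuousOn_uncurry_of_stLift_continuousOn` of
`Literature/Analysis/FluidPDE/ReleaseKernelFamily.lean`, here through `Filter.map_inf_principal_preimage`). -/
theorem continuousOn_uncurry_of_stLift {F : Type*} [TopologicalSpace F] {S : Set ℝ}
    {u : ℝ → T3 → F} (hu : ContinuousOn (Torus.stLift u) (S ×ˢ univ)) :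
    ContinuousOn (Function.uncurry u) (S ×ˢ univ) := by
  rintro ⟨s, x⟩ hsx
  obtain ⟨y, rfl⟩ := Torus.proj_surjective x
  have hp : IsOpenQuotientMap (Prod.map id Torus.proj : ℝ × V3 → ℝ × T3) :=
    IsOpenQuotientMap.id.prodMap Torus.isOpenQuotientMap_proj
  have hpre : (Prod.map id Torus.proj : ℝ × V3 → ℝ × T3) ⁻¹' (S ×ˢ univ) = S ×ˢ univ := by
    ext q
    simp
  have hq : ((s, Torus.proj y) : ℝ × T3) = Prod.map id Torus.proj (s, y) := rfl
  unfold ContinuousWithinAt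
  rw [nhdsWithin, hq, ← hp.map_nhds_eq (s, y), ← Filter.map_inf_principal_preimage, hpre,
    Filter.tendsto_map'_iff]
  exact hu (s, y) ⟨hsx.1, mem_univ _⟩

/-- Chain rule along a uniform motion on the torus: for `u` jointly smooth on `[0, t] × T³`, an
interior time `s₀ ∈ (0, t)`, a point `x` and a velocity `v`, the map `s ↦ u s (x + proj ((s - s₀) • v))`
has derivative `∂ₛu(s₀, x) + Σⱼ vⱼ ∂ⱼu(s₀, x)` at `s₀`. -/
theorem hasDerivAt_comp_line {t : ℝ} {u : ℝ → T3 → ℝ}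
    (hu : Torus.IsSmoothSpaceTimeOn (Icc 0 t) u) (ht : 0 < t) {s₀ : ℝ} (hs₀ : s₀ ∈ Ioo 0 t)
    (x : T3) (v : V3) :
    HasDerivAt (fun s => u s (x + Torus.proj ((s - s₀) • v)))
      (Torus.timeDerivWithin (Icc 0 t) u s₀ x + ∑ j, v j * Torus.partialDeriv j (u s₀) x) s₀ := by
  obtain ⟨y, rfl⟩ := Torus.proj_surjective x
  have hS : UniqueDiffOn ℝ (Icc 0 t) := uniqueDiffOn_Icc ht
  have hs₀' : s₀ ∈ Icc 0 t := Ioo_subset_Icc_self hs₀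
  have hmem : ((s₀, y) : ℝ × V3) ∈ Icc 0 t ×ˢ (univ : Set V3) := ⟨hs₀', mem_univ _⟩
  have hnhds : Icc 0 t ×ˢ (univ : Set V3) ∈ 𝓝 ((s₀, y) : ℝ × V3) :=
    prod_mem_nhds (Icc_mem_nhds hs₀.1 hs₀.2) univ_mem
  have hdiff : HasFDerivAt (Torus.stLift u)
      (fderivWithin ℝ (Torus.stLift u) (Icc 0 t ×ˢ univ) (s₀, y)) (s₀, y + (s₀ - s₀) • v) := by
    rw [sub_self, zero_smul, add_zero, fderivWithin_of_mem_nhds hnhds]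
    exact ((hu.differentiableOn (by simp) (s₀, y) hmem).differentiableAt hnhds).hasFDerivAt
  have hc : HasDerivAt (fun s : ℝ => ((s, y + (s - s₀) • v) : ℝ × V3)) ((1 : ℝ), v) s₀ := by
    have h1 : HasDerivAt (fun s : ℝ => y + (s - s₀) • v) v s₀ := by
      simpa using ((hasDerivAt_id' (x := s₀)).sub_const s₀).smul_const v |>.const_add y
    exact (hasDerivAt_id' (x := s₀)).prodMk h1
  have hcomp := hdiff.comp_hasDerivAt s₀ hc
  have heq : (Torus.stLift u ∘ fun s : ℝ => ((s, y + (s - s₀) • v) : ℝ × V3)) =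
      fun s => u s (Torus.proj y + Torus.proj ((s - s₀) • v)) := by
    funext s
    rfl
  rw [heq] at hcomp
  refine hcomp.congr_deriv ?_
  have hsplit : ((1 : ℝ), v) = ((1 : ℝ), (0 : V3)) + ((0 : ℝ), v) := by simp
  rw [hsplit, map_add, ← hu.timeDerivWithin_apply_proj hS hs₀' y, ← hu.fderiv_slice_apply hs₀' y v,
    Torus.fderiv_apply_eq_sum_partialDeriv ((hu.isSmooth_slice hs₀').isContDiff (by simp)) _ v]
  simp only [smul_eq_mul]

end SpaceTime

/-! ## Hard-sphere trajectories: free flight to the right, constant velocities between collisions -/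

section Trajectory

variable {d : Type*} [Fintype d] {X : Type*} [TopologicalSpace X] {n : ℕ}
  {G : Geometry d X} {ε : ℝ} {γ : ℝ → Config n d X}

/-- On a hard-sphere trajectory every time `s₀` is followed by a short stretch of free flight:
`γ s = freeFlight G (s - s₀) (γ s₀)` for `s ∈ [s₀, s₀ + δ)` (the collision times in `(s₀, s₀ + 1]`
are finite, hence bounded away from `s₀`; then the `free` axiom). -/
theorem traj_freeFlight_right (hγ : IsHardSphereTrajectory G ε n γ) (s₀ : ℝ) :
    ∃ δ > 0, ∀ s ∈ Ico s₀ (s₀ + δ), γ s = freeFlight G (s - s₀) (γ s₀) := by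
  have hfin : (collisionTimes G ε γ ∩ Ioc s₀ (s₀ + 1)).Finite :=
    (hγ.locFinite s₀ (s₀ + 1)).subset (inter_subset_inter_right _ Ioc_subset_Icc_self)
  have hs₀ : s₀ ∈ (collisionTimes G ε γ ∩ Ioc s₀ (s₀ + 1))ᶜ := fun h => lt_irrefl s₀ h.2.1
  obtain ⟨δ₁, hδ₁, hball⟩ := Metric.isOpen_iff.1 hfin.isClosed.isOpen_compl s₀ hs₀
  refine ⟨min δ₁ 1, lt_min hδ₁ one_pos, fun s hs => hγ.free s₀ s hs.1 fun τ hτ hτC => ?_⟩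
  have hτball : τ ∈ Metric.ball s₀ δ₁ := by
    rw [Metric.mem_ball, Real.dist_eq, abs_of_pos (sub_pos.2 hτ.1)]
    linarith [hτ.2, hs.2, min_le_left δ₁ 1]
  exact hball hτball ⟨hτC, hτ.1, by linarith [hτ.2, hs.2, min_le_right δ₁ 1]⟩

/-- On a collision-free open time interval the velocities of a hard-sphere trajectory are constant. -/
theorem traj_vel_eq_of_free (hγ : IsHardSphereTrajectory G ε n γ) {a b : ℝ}
    (hfree : ∀ τ ∈ Ioo a b, τ ∉ collisionTimes G ε γ) {m s : ℝ} (hm : m ∈ Ioo a b)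
    (hs : s ∈ Ioo a b) (i : Fin n) : (γ s i).2 = (γ m i).2 := by
  rcases le_total m s with hms | hsm
  · have h := hγ.free m s hms fun τ hτ => hfree τ ⟨hm.1.trans hτ.1, hτ.2.trans_lt hs.2⟩
    rw [h, freeFlight_apply]
  · have h := hγ.free s m hsm fun τ hτ => hfree τ ⟨hs.1.trans hτ.1, hτ.2.trans_lt hm.2⟩
    rw [h, freeFlight_apply]

end Trajectory

/-! ## One particle: continuity, right derivative, integrability, fundamental theorem of calculus -/

section Particle

variable {N : ℕ} {ε : ℝ} {γ : ℝ → Config (N + 1) (Fin 3) T3}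

/-- Along a hard-sphere trajectory, a field jointly continuous on `S × T³` evaluated at the position of
particle `i` is continuous in time on `S` (positions are continuous). -/
theorem traj_continuousOn_comp (hγ : IsHardSphereTrajectory (Torus.geometry (Fin 3)) ε (N + 1) γ)
    {S : Set ℝ} {u : ℝ → T3 → ℝ} (hu : ContinuousOn (Function.uncurry u) (S ×ˢ univ))
    (i : Fin (N + 1)) : ContinuousOn (fun s => u s (γ s i).1) S :=
  hu.comp (f := fun s => (s, (γ s i).1)) (continuous_id.prodMk (hγ.pos_continuous i)).continuousOn
    fun _ hs => ⟨hs, mem_univ _⟩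

/-- RIGHT derivative of `s ↦ u s (xᵢ(s))` along a hard-sphere trajectory at an interior time
`s₀ ∈ (0, t)`, for `u` jointly smooth on `[0, t] × T³`: it is
`∂ₛu(s₀, xᵢ(s₀)) + Σⱼ vᵢ(s₀)ⱼ ∂ⱼu(s₀, xᵢ(s₀))` (free flight to the right of `s₀` and the chain rule;
at a collision time `vᵢ(s₀)` is the post-collisional velocity, the trajectory being right-continuous). -/
theorem traj_hasDerivWithinAt (hγ : IsHardSphereTrajectory (Torus.geometry (Fin 3)) ε (N + 1) γ)
    {t : ℝ} (ht : 0 < t) {u : ℝ → T3 → ℝ} (hu : Torus.IsSmoothSpaceTimeOn (Icc 0 t) u)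
    {s₀ : ℝ} (hs₀ : s₀ ∈ Ioo 0 t) (i : Fin (N + 1)) :
    HasDerivWithinAt (fun s => u s (γ s i).1)
      (Torus.timeDerivWithin (Icc 0 t) u s₀ (γ s₀ i).1 +
        ∑ j, (γ s₀ i).2 j * Torus.partialDeriv j (u s₀) (γ s₀ i).1) (Ioi s₀) s₀ := by
  obtain ⟨δ, hδ, hflight⟩ := traj_freeFlight_right hγ s₀
  refine ((hasDerivAt_comp_line hu ht hs₀ (γ s₀ i).1 (γ s₀ i).2).hasDerivWithinAt
    (s := Ioi s₀)).congr_of_eventuallyEq ?_ ?_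
  · filter_upwards [Ioo_mem_nhdsGT (show s₀ < s₀ + δ by linarith)] with s hs
    rw [hflight s ⟨hs.1.le, hs.2⟩, freeFlight_apply, Torus.geometry_translate]
  · simp

/-- Interval integrability of the free-streaming derivative
`s ↦ A s (xᵢ(s)) + Σⱼ vᵢ(s)ⱼ Bⱼ s (xᵢ(s))` on a collision-free window `[a, b] ⊆ [0, t]`, for
fields `A`, `Bⱼ` jointly continuous on `[0, t] × T³`: on `(a, b)` the velocity is constant, so the
integrand agrees there with a function continuous on `[a, b]`. -/
theorem traj_intervalIntegrable_of_free
    (hγ : IsHardSphereTrajectory (Torus.geometry (Fin 3)) ε (N + 1) γ) {t : ℝ}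
    {A : ℝ → T3 → ℝ} {B : Fin 3 → ℝ → T3 → ℝ}
    (hA : ContinuousOn (Function.uncurry A) (Icc 0 t ×ˢ univ))
    (hB : ∀ j, ContinuousOn (Function.uncurry (B j)) (Icc 0 t ×ˢ univ)) (i : Fin (N + 1))
    {a b : ℝ} (ha : 0 ≤ a) (hab : a ≤ b) (hb : b ≤ t)
    (hfree : ∀ τ ∈ Ioo a b, τ ∉ collisionTimes (Torus.geometry (Fin 3)) ε γ) :
    IntervalIntegrable (fun s => A s (γ s i).1 + ∑ j, (γ s i).2 j * B j s (γ s i).1) volume a b := by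
  have hsub : Icc a b ⊆ Icc 0 t := Icc_subset_Icc ha hb
  have hcont : ContinuousOn
      (fun s => A s (γ s i).1 + ∑ j, (γ ((a + b) / 2) i).2 j * B j s (γ s i).1) (Icc a b) :=
    ((traj_continuousOn_comp hγ hA i).mono hsub).add
      (continuousOn_finsetSum _ fun j _ =>
        continuousOn_const.mul ((traj_continuousOn_comp hγ (hB j) i).mono hsub))
  have hint := (intervalIntegrable_iff_integrableOn_Ioo_of_le hab).1
    (hcont.intervalIntegrable_of_Icc (μ := volume) hab)
  refine (intervalIntegrable_iff_integrableOn_Ioo_of_le hab).2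
    (hint.congr_fun (fun s hs => ?_) measurableSet_Ioo)
  have hab' : a < b := hs.1.trans hs.2
  have hm : (a + b) / 2 ∈ Ioo a b := ⟨by linarith, by linarith⟩
  simp only [traj_vel_eq_of_free hγ hfree hm hs i]

/-- Interval integrability on `[0, τ] ⊆ [0, t]` of the free-streaming derivative of the previous
lemma: induction on the finite set of collision times in `[0, t]`, splitting the window at each of
them (`IntervalIntegrable.trans`). -/
theorem traj_intervalIntegrable
    (hγ : IsHardSphereTrajectory (Torus.geometry (Fin 3)) ε (N + 1) γ) {t : ℝ}
    {A : ℝ → T3 → ℝ} {B : Fin 3 → ℝ → T3 → ℝ}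
    (hA : ContinuousOn (Function.uncurry A) (Icc 0 t ×ˢ univ))
    (hB : ∀ j, ContinuousOn (Function.uncurry (B j)) (Icc 0 t ×ˢ univ)) (i : Fin (N + 1))
    {τ : ℝ} (hτ : τ ∈ Icc 0 t) :
    IntervalIntegrable (fun s => A s (γ s i).1 + ∑ j, (γ s i).2 j * B j s (γ s i).1) volume 0 τ := by
  classical
  suffices H : ∀ (D : Finset ℝ) (a b : ℝ), 0 ≤ a → a ≤ b → b ≤ t →
      (∀ c ∈ Ioo a b, c ∈ collisionTimes (Torus.geometry (Fin 3)) ε γ → c ∈ D) →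
      IntervalIntegrable (fun s => A s (γ s i).1 + ∑ j, (γ s i).2 j * B j s (γ s i).1)
        volume a b by
    exact H (hγ.locFinite 0 t).toFinset 0 τ le_rfl hτ.1 hτ.2 fun c hc hcC =>
      (hγ.locFinite 0 t).mem_toFinset.2 ⟨hcC, hc.1.le, hc.2.le.trans hτ.2⟩
  intro D
  induction D using Finset.induction_on with
  | empty =>
    intro a b ha hab hb hD
    exact traj_intervalIntegrable_of_free hγ hA hB i ha hab hb fun c hc hcC => by
      simpa using hD c hc hcC
  | @insert c D _ ih =>
    intro a b ha hab hb hD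
    by_cases hc : c ∈ Ioo a b
    · refine (ih a c ha hc.1.le (hc.2.le.trans hb) fun c' hc' hc'C => ?_).trans
        (ih c b (ha.trans hc.1.le) hc.2.le hb fun c' hc' hc'C => ?_)
      · exact (Finset.mem_insert.1 (hD c' ⟨hc'.1, hc'.2.trans hc.2⟩ hc'C)).resolve_left
          (ne_of_lt hc'.2)
      · exact (Finset.mem_insert.1 (hD c' ⟨hc.1.trans hc'.1, hc'.2⟩ hc'C)).resolve_left
          (ne_of_gt hc'.1)
    · exact ih a b ha hab hb fun c' hc' hc'C =>
        (Finset.mem_insert.1 (hD c' hc' hc'C)).resolve_left fun h => hc (h ▸ hc')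

/-- Interval integrability on `[0, τ] ⊆ [0, t]` of the free-streaming derivative
`s ↦ ∂ₛu(s, xᵢ(s)) + Σⱼ vᵢ(s)ⱼ ∂ⱼu(s, xᵢ(s))` of a jointly smooth `u` along a hard-sphere
trajectory (`∂ₛu` and `∂ⱼu` are jointly smooth on `[0, t] × T³`, hence jointly continuous). -/
theorem traj_intervalIntegrable_smooth
    (hγ : IsHardSphereTrajectory (Torus.geometry (Fin 3)) ε (N + 1) γ) {t : ℝ} (ht : 0 < t)
    {u : ℝ → T3 → ℝ} (hu : Torus.IsSmoothSpaceTimeOn (Icc 0 t) u) (i : Fin (N + 1)) {τ : ℝ}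
    (hτ : τ ∈ Icc 0 t) :
    IntervalIntegrable (fun s => Torus.timeDerivWithin (Icc 0 t) u s (γ s i).1 +
      ∑ j, (γ s i).2 j * Torus.partialDeriv j (u s) (γ s i).1) volume 0 τ := by
  have hS : UniqueDiffOn ℝ (Icc 0 t) := uniqueDiffOn_Icc ht
  exact traj_intervalIntegrable hγ (A := Torus.timeDerivWithin (Icc 0 t) u)
    (B := fun j s => Torus.partialDeriv j (u s))
    (continuousOn_uncurry_of_stLift (hu.timeDerivWithin hS).continuousOn_stLift)
    (fun j => continuousOn_uncurry_of_stLift (hu.partialDeriv hS j).continuousOn_stLift) i hτ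

/-- The one-particle balance: for `u` jointly smooth on `[0, t] × T³`, a hard-sphere trajectory `γ`
and `τ ∈ [0, t]`,
`∫₀^τ (∂ₛu(s, xᵢ(s)) + Σⱼ vᵢ(s)ⱼ ∂ⱼu(s, xᵢ(s))) ds = u(τ, xᵢ(τ)) - u(0, xᵢ(0))`
(fundamental theorem of calculus for a continuous function with an integrable right derivative). -/
theorem traj_integral_eq_sub (hγ : IsHardSphereTrajectory (Torus.geometry (Fin 3)) ε (N + 1) γ)
    {t : ℝ} (ht : 0 < t) {u : ℝ → T3 → ℝ} (hu : Torus.IsSmoothSpaceTimeOn (Icc 0 t) u)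
    (i : Fin (N + 1)) {τ : ℝ} (hτ : τ ∈ Icc 0 t) :
    ∫ s in 0..τ, (Torus.timeDerivWithin (Icc 0 t) u s (γ s i).1 +
        ∑ j, (γ s i).2 j * Torus.partialDeriv j (u s) (γ s i).1) =
      u τ (γ τ i).1 - u 0 (γ 0 i).1 :=
  intervalIntegral.integral_eq_sub_of_hasDeriv_right_of_le hτ.1
    ((traj_continuousOn_comp hγ (continuousOn_uncurry_of_stLift hu.continuousOn_stLift) i).mono
      (Icc_subset_Icc_right hτ.2))
    (fun _ hs => traj_hasDerivWithinAt hγ ht hu ⟨hs.1, hs.2.trans_le hτ.2⟩ i)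
    (traj_intervalIntegrable_smooth hγ ht hu i hτ)

end Particle

/-! ## The stub -/

/-- **(B1) of `BalanceIdentity`.** On a good trajectory of a hard-sphere flow, the empirical position
functional of a jointly smooth test function `lam0` on `[0, t] × T³` satisfies, for `τ ∈ [0, t]`,
`⟨emp(Φ_τ z), lam0(τ, ·)⟩ - ⟨emp z, lam0(0, ·)⟩ = ∫_{[0,τ]} ⟨emp(Φ_s z), ∂ₛlam0(s, ·) + v·∇lam0(s, ·)⟩ ds`:
the average over the `N + 1` particles (`integral_empiricalMeasure`) of the one-particle balances
`traj_integral_eq_sub`, with `Φ_0 z = z` on the good set. -/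
theorem stub_balance_B1 : ∀ σ : ℝ, 0 < σ → σ < 2⁻¹ → ∀ (N : ℕ) (Φ : Flow σ N) (t : ℝ), 0 < t → ∀ lam0 : ℝ → T3 → ℝ, Torus.IsSmoothSpaceTimeOn (Icc 0 t) lam0 → ∀ z ∈ Φ.good, ∀ τ ∈ Icc 0 t, (∫ y, lam0 τ y.1 ∂(empiricalMeasure (Φ.flow τ z))) - ∫ y, lam0 0 y.1 ∂(empiricalMeasure z) = ∫ s in Icc 0 τ, ∫ y, (Torus.timeDerivWithin (Icc 0 t) lam0 s y.1 + ∑ j, y.2 j * Torus.partialDeriv j (lam0 s) y.1) ∂(empiricalMeasure (Φ.flow s z)) := by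
  intro σ _ _ N Φ t ht lam0 hlam z hz τ hτ
  have hγ : IsHardSphereTrajectory (Torus.geometry (Fin 3)) (hsDiameter σ N) (N + 1)
      fun s => Φ.flow s z :=
    Φ.isTrajectory z hz
  -- the one-particle balances, as set integrals over `Icc 0 τ`, started from `Φ_0 z = z`
  have hP : ∀ i : Fin (N + 1),
      ∫ s in Icc 0 τ, (Torus.timeDerivWithin (Icc 0 t) lam0 s (Φ.flow s z i).1 +
        ∑ j, (Φ.flow s z i).2 j * Torus.partialDeriv j (lam0 s) (Φ.flow s z i).1) =
      lam0 τ (Φ.flow τ z i).1 - lam0 0 (z i).1 := by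
    intro i
    have h := traj_integral_eq_sub hγ ht hlam i hτ
    simp only [Φ.flow_zero z hz] at h
    rw [integral_Icc_eq_integral_Ioc, ← intervalIntegral.integral_of_le hτ.1]
    exact h
  -- integrability of each one-particle integrand on `Icc 0 τ`
  have hI : ∀ i : Fin (N + 1),
      IntegrableOn (fun s => Torus.timeDerivWithin (Icc 0 t) lam0 s (Φ.flow s z i).1 +
        ∑ j, (Φ.flow s z i).2 j * Torus.partialDeriv j (lam0 s) (Φ.flow s z i).1) (Icc 0 τ) volume :=
    fun i => (intervalIntegrable_iff_integrableOn_Icc_of_le hτ.1).1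
      (traj_intervalIntegrable_smooth hγ ht hlam i hτ)
  simp_rw [integral_empiricalMeasure]
  rw [integral_const_mul, integral_finsetSum _ fun i _ => hI i]
  simp only [hP]
  rw [Finset.sum_sub_distrib, mul_sub]

end Barycentric

end Summit.AtomisticToContinuum.HydrodynamicLimit.Theorems.MacroClosureLine

end
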